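import Summits.QuantumFields.BalabanUV.Beta.GAN24.TaylorTrilinearTransport

/-!
# `BalabanUV.Beta.GAN24.TaylorTrilinearTransportBound` — binder row G-an2-4 ∕ (CONV-C), S-slot, road «S3-Taylor», DIFF row R3-dW:
# generic leaf, PART 6 of 7 — `(II)`: THE LEVEL-`N′` FUNCTIONAL OF THE TRANSPORTED LEGS VERSUS THE LEVEL-`N` FUNCTIONAL IS `O(1/N)`

G-an2-4 formalisation swarm, leaf prover 15 (unit `b2b-balaban-gan24-formalise-leaf-15`, gen 14; DIFF row R3-dW holder, INTENT
CLAIMS.log l.4908).  HONEST FRAMING (cell rule, verbatim): «discharging `BetaPertH` makes Bałaban's UV stability UNCONDITIONAL — a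
real constructive-QFT result; it is NOT the continuum limit and NOT the Clay problem.»  HONEST DEPENDENCY (verbatim): «continuum YM
on T⁴ ⇐ BetaPertH ∧ nine spine estimates (0/9 proved); BetaPertH ⇐ (D1) ∧ (D4) ∧ CAP+tail; G-an2-4 gates asym, D1 and NE2/3/4.»
NOT IN PRINT; OUR BOOKKEEPING ([folklore]): elementary real analysis ∕ finite algebra on `ℤ^{d+1}`, GENERIC `d`, GENERIC blockings,
ABSTRACT legs and table; NO object of an2's typed `U = 1` system occurs, nothing is cited, no `def … : Prop`, NOTHING is asserted
or discharged of «E3Shape»∕«E3SupRate» (OPEN, not in print), of (hS, hSall), of the K-slot, of `BetaPertH`.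
NOT BetaPertH, NOT continuum, NOT Clay.

CONTEXT (asserted nowhere below).  The RATE table of the S-slot (`GAN24/StencilSlotE3RateOfPieces.e3SupRate_of_pieces`,
row owner gan24-p1) has the DIFFERENCE row R3-dW: the Wilson piece of the normalised third jet at member `n+3` (blocking
`N′ = N·Lc`) minus the one at member `n+2` (blocking `N`), `≤ cW·θ^{n+1}`.  By `E3UnitSplit.e3W_unit_split` both are (at
`d = 3`, residual `1`) the SAME unit sandwich functional — three legs, one block average, ONE explicit factor of the blocking
on the SAME translation-invariant zero-row-sum table `wilsonA` — read at two blockings.  This chain of generic leaves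
(`TaylorTrilinearCarry` ∕ `…Pairing` ∕ `…DiffSlices` ∕ `…DiffSummed` ∕ `…Transport` ∕ `…TransportBound` ∕ `…Diff`) proves the
two-level difference bound `TaylorTrilinearDiff.trilinear_diff_bound`: TRANSPORT the level-`N` legs to the finer lattice by
`quo Lc` (piecewise constant on cells), split trilinearly — the couplings «(N1-Cauchy)» enter BY THEIR SUP ONLY thanks to ONE
ABEL SUMMATION in the vertex location — and compare the transported functional with the original one EXACTLY through the
CARRY TABLE of a cell (Hermite's identity: same row sum, same first moments ⇒ second order ⇒ `O(1/N)` by the pairing lemma).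

## What is proved ([folklore], `0 sorry`)
* `abs_tsum_groupK_le`, `abs_tsum_groupG_le` (the two remainder groups in the final `1/N` form: pairing lemma with `A = H·G`, `F = K`,
  resp. `A = H·K`, `F = G`; `TaylorBlockSum.blockSum_exp_le` BY NAME), `abs_tsum_mixed_le` (W4), **`abs_tsum_transport_sub_le`**:
  `|Σ'_u slice N′^{-(d+1)} N′ (G∘quo L) (K∘quo L) (H∘quo L) u − Σ'_v slice N^{-(d+1)} N G K H v|
   ≤ (1/N)·(d+1)³|B|²·C_T·(L+1)·R²·e^{2δR}·((C′_H C_G + C_H C′_G)C′_K + (C′_H C_K + C_H C′_K)C′_G + C_H C′_G C′_K)·Zl(δ/2)·E`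
  (`N′ = L·N`; cells `KKTFluctuationEnergy.tsum_blocks`; (N1)+(N1′)-type hypotheses on ALL THREE level-`N` legs).
-/

noncomputable section

open Finset
open scoped BigOperators
open Literature.MathematicalPhysics.QuantumFieldTheory Balaban1983to89 Balaban1983to89.Beta
open B12Sec2to5 (l1 l1_nonneg)
open ExpKernelCalculus (Zl l1_sub_triangle l1_sub_symm)
open LatticeForm (quo)
open KKTFluctuationEnergy (tsum_blocks quo_zsmul_add_toSite)
open AffineAveraging (box toSite)

namespace Summit.QuantumFields.BalabanUV.Beta.GAN24.TaylorTrilinearTransportBound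

open Summit.QuantumFields.BalabanUV.Beta.GAN24.TaylorTrilinearLattice
open Summit.QuantumFields.BalabanUV.Beta.GAN24.TaylorTrilinear (nonneg_of_abs_le_mul_exp abs_le_of_abs_le_mul_exp)
open Summit.QuantumFields.BalabanUV.Beta.GAN24.TaylorTrilinearCarry
open Summit.QuantumFields.BalabanUV.Beta.GAN24.TaylorTrilinearPairing
open Summit.QuantumFields.BalabanUV.Beta.GAN24.TaylorTrilinearDiffSlices
open Summit.QuantumFields.BalabanUV.Beta.GAN24.TaylorTrilinearTransport

variable {d : ℕ}

/-! ## §1 The transported-versus-original discrepancy `(II)`, summed over the vertex location: `O(1/N)` -/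

section BoundII

variable (N L N' : ℕ) [NeZero N] [NeZero L] [NeZero N'] (G K H : Fin (d + 1) → (Fin (d + 1) → ℤ) → ℝ)
  (T : Fin (d + 1) → (Fin (d + 1) → ℤ) → (Fin (d + 1) → ℤ) → (Fin (d + 1) → ℤ) → Fin (d + 1) → Fin (d + 1) → ℝ)
  (B : Finset (Fin (d + 1) → ℤ)) (x' z' u' : Fin (d + 1) → ℤ) {δ CG CG' CK CK' CH CH' CT : ℝ} {R : ℕ}

/-- [folklore] THE `K`-REMAINDER GROUP of `(II)` in the final `1/N` form (pairing lemma with `A = H·G`, `F = K`). -/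
theorem abs_tsum_groupK_le (hδ : 0 < δ) (hCG' : 0 ≤ CG') (hCK' : 0 ≤ CK') (hCH' : 0 ≤ CH')
    (hG : ∀ l w, |G l w| ≤ CG * Real.exp (-δ * l1 (quo N w - x')))
    (hG' : ∀ l w j, |G l (w + Pi.single j 1) - G l w| ≤ CG' / N * Real.exp (-δ * l1 (quo N w - x')))
    (hK' : ∀ l y j, |K l (y + Pi.single j 1) - K l y| ≤ CK' / N * Real.exp (-δ * l1 (quo N y - z')))
    (hH : ∀ κ v, |H κ v| ≤ CH * Real.exp (-δ * l1 (quo N v - u')))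
    (hH' : ∀ κ v j, |H κ (v + Pi.single j 1) - H κ v| ≤ CH' / N * Real.exp (-δ * l1 (quo N v - u')))
    (hB : ∀ s ∈ B, LatticeForm.l1 s ≤ R) (hT0 : ∀ κ v w y l l', |T κ v w y l l'| ≤ CT)
    {lam : ℝ} (hlam0 : 0 ≤ lam) (hlamL : lam * (box (d + 1) L).card = L) :
    |∑' v, ∑ t ∈ B, ∑ s ∈ B, ∑ l' : Fin (d + 1), ∑ l : Fin (d + 1), ∑ κ : Fin (d + 1),
      (((N : ℝ) ^ (d + 1))⁻¹ * N) * T κ 0 s t l l' * (H κ v * G l v) *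
        (lam * (∑ r ∈ box (d + 1) L, rem2 (K l') (quo L (toSite r + t)) v) - rem2 (K l') t v)| ≤
      (1 / N) * (((d : ℝ) + 1) ^ 3 * (B.card : ℝ) ^ 2 * CT * ((L : ℝ) + 1) * R ^ 2 * Real.exp (2 * δ * R) *
        ((CH' * CG + CH * CG') * CK') * Zl (d + 1) (δ / 2)) * Real.exp (-(δ / 2) * (l1 (x' - u') + l1 (z' - u'))) := by
  have hN : (0 : ℝ) < N := by exact_mod_cast Nat.pos_of_ne_zero (NeZero.ne N)
  have hCT : 0 ≤ CT := (abs_nonneg _).trans (hT0 0 0 0 0 0 0)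
  have hCG : 0 ≤ CG := nonneg_of_abs_le_mul_exp hδ.le (l1_nonneg _) (hG 0 0)
  have hCH : 0 ≤ CH := nonneg_of_abs_le_mul_exp hδ.le (l1_nonneg _) (hH 0 0)
  have hR : (0 : ℝ) ≤ R := by positivity
  have idK : ∀ Z E : ℝ, (B.card : ℝ) ^ 2 * ((d : ℝ) + 1) ^ 3 * (CT * ((L : ℝ) + 1) * R * ((R / N) * Real.exp (2 * δ * R) *
      (CH' * CG + CH * CG')) * (CK' / N) * (N * (Z * E))) =
      (1 / N) * (((d : ℝ) + 1) ^ 3 * (B.card : ℝ) ^ 2 * CT * ((L : ℝ) + 1) * R ^ 2 * Real.exp (2 * δ * R) *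
        ((CH' * CG + CH * CG') * CK') * Z) * E := by
    intro Z E
    have hNi : ((N : ℝ))⁻¹ * ((N : ℝ))⁻¹ * N = ((N : ℝ))⁻¹ := by rw [mul_assoc, inv_mul_cancel₀ hN.ne', mul_one]
    simp only [div_eq_mul_inv, one_mul]
    calc _ = ((B.card : ℝ) ^ 2 * ((d : ℝ) + 1) ^ 3 * CT * ((L : ℝ) + 1) * R * R * Real.exp (2 * δ * R) *
        (CH' * CG + CH * CG') * CK' * Z * E) * (((N : ℝ))⁻¹ * ((N : ℝ))⁻¹ * N) := by ring
      _ = _ := by rw [hNi]; ring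
  have hAK : ∀ (κ l l' : Fin (d + 1)) v, |H κ v * G l v| ≤ CH * CG *
      Real.exp (-δ * (l1 (quo N v - u') + l1 (quo N v - x'))) := by
    intro κ l _ v
    rw [abs_mul, show -δ * (l1 (quo N v - u') + l1 (quo N v - x')) = -δ * l1 (quo N v - u') + -δ * l1 (quo N v - x') by
      ring, Real.exp_add]
    calc |H κ v| * |G l v| ≤ (CH * Real.exp (-δ * l1 (quo N v - u'))) * (CG * Real.exp (-δ * l1 (quo N v - x'))) :=
          mul_le_mul (hH κ v) (hG l v) (abs_nonneg _) ((abs_nonneg _).trans (hH κ v))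
      _ = _ := by ring
  have hAK' : ∀ (κ l l' : Fin (d + 1)) v b, LatticeForm.l1 b ≤ R → |H κ (v - b) * G l (v - b) - H κ v * G l v| ≤
      (R / N) * Real.exp (2 * δ * R) * (CH' * CG + CH * CG') * Real.exp (-δ * (l1 (quo N v - u') + l1 (quo N v - x'))) :=
    fun κ l _ v b hb => abs_prod_shift_sub_le N hδ.le hCH' hCG' (hH κ) (hH' κ) (hG l) (hG' l) v hb
  have hKβ : ∀ (l l' : Fin (d + 1)) v j, |K l' (v + Pi.single j 1) - K l' v| ≤ CK' / N * Real.exp (-δ * l1 (quo N v - z')) :=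
    fun _ l' v j => hK' l' v j
  have hT00 : ∀ κ s t l l', |T κ 0 s t l l'| ≤ CT := fun κ s t l l' => hT0 κ 0 s t l l'
  have hofft : ∀ s ∈ B, ∀ t ∈ B, LatticeForm.l1 ((fun (_ t : Fin (d + 1) → ℤ) => t) s t) ≤ R := fun s _ t ht => hB t ht
  have bK := abs_tsum_group_le N L (fun κ l _ v => H κ v * G l v) (fun _ l' => K l') (fun κ s t l l' => T κ 0 s t l l')
    (fun _ t => t) B u' x' z' (c := ((N : ℝ) ^ (d + 1))⁻¹ * N) hδ (by positivity) hlam0 hlamL (by positivity)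
    (div_nonneg hCK' hN.le) hAK hAK' hKβ hofft hT00
  have hS3 : (((N : ℝ) ^ (d + 1))⁻¹ * N) * ∑' v, Real.exp (-δ * (l1 (quo N v - u') + l1 (quo N v - x') + l1 (quo N v - z')))
      ≤ N * (Zl (d + 1) (δ / 2) * Real.exp (-(δ / 2) * (l1 (x' - u') + l1 (z' - u')))) := by
    rw [mul_comm (((N : ℝ) ^ (d + 1))⁻¹), mul_assoc, ← tsum_mul_left]
    refine mul_le_mul_of_nonneg_left ?_ hN.le
    refine le_trans (le_of_eq (tsum_congr fun v => ?_)) (TaylorBlockSum.blockSum_exp_le (N := N) hδ x' u' z')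
    rw [add_comm (l1 (quo N v - u')) (l1 (quo N v - x'))]
  refine bK.trans ?_
  rw [← idK]
  have e : (((N : ℝ) ^ (d + 1))⁻¹ * N) * CT * ((L : ℝ) + 1) * R * ((R / N) * Real.exp (2 * δ * R) * (CH' * CG + CH * CG')) *
      (CK' / N) * ∑' v, Real.exp (-δ * (l1 (quo N v - u') + l1 (quo N v - x') + l1 (quo N v - z'))) =
      CT * ((L : ℝ) + 1) * R * ((R / N) * Real.exp (2 * δ * R) * (CH' * CG + CH * CG')) * (CK' / N) *
      ((((N : ℝ) ^ (d + 1))⁻¹ * N) * ∑' v, Real.exp (-δ * (l1 (quo N v - u') + l1 (quo N v - x') + l1 (quo N v - z')))) := by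
    ring
  rw [e]
  have h0 : 0 ≤ CT * ((L : ℝ) + 1) * R * ((R / N) * Real.exp (2 * δ * R) * (CH' * CG + CH * CG')) * (CK' / N) := by
    positivity
  exact mul_le_mul_of_nonneg_left (mul_le_mul_of_nonneg_left hS3 h0) (by positivity)

/-- [folklore] THE `G`-REMAINDER GROUP of `(II)` in the final `1/N` form (pairing lemma with `A = H·K`, `F = G`). -/
theorem abs_tsum_groupG_le (hδ : 0 < δ) (hCG' : 0 ≤ CG') (hCK' : 0 ≤ CK') (hCH' : 0 ≤ CH')
    (hG' : ∀ l w j, |G l (w + Pi.single j 1) - G l w| ≤ CG' / N * Real.exp (-δ * l1 (quo N w - x')))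
    (hK : ∀ l y, |K l y| ≤ CK * Real.exp (-δ * l1 (quo N y - z')))
    (hK' : ∀ l y j, |K l (y + Pi.single j 1) - K l y| ≤ CK' / N * Real.exp (-δ * l1 (quo N y - z')))
    (hH : ∀ κ v, |H κ v| ≤ CH * Real.exp (-δ * l1 (quo N v - u')))
    (hH' : ∀ κ v j, |H κ (v + Pi.single j 1) - H κ v| ≤ CH' / N * Real.exp (-δ * l1 (quo N v - u')))
    (hB : ∀ s ∈ B, LatticeForm.l1 s ≤ R) (hT0 : ∀ κ v w y l l', |T κ v w y l l'| ≤ CT)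
    {lam : ℝ} (hlam0 : 0 ≤ lam) (hlamL : lam * (box (d + 1) L).card = L) :
    |∑' v, ∑ t ∈ B, ∑ s ∈ B, ∑ l' : Fin (d + 1), ∑ l : Fin (d + 1), ∑ κ : Fin (d + 1),
      (((N : ℝ) ^ (d + 1))⁻¹ * N) * T κ 0 s t l l' * (H κ v * K l' v) *
        (lam * (∑ r ∈ box (d + 1) L, rem2 (G l) (quo L (toSite r + s)) v) - rem2 (G l) s v)| ≤
      (1 / N) * (((d : ℝ) + 1) ^ 3 * (B.card : ℝ) ^ 2 * CT * ((L : ℝ) + 1) * R ^ 2 * Real.exp (2 * δ * R) *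
        ((CH' * CK + CH * CK') * CG') * Zl (d + 1) (δ / 2)) * Real.exp (-(δ / 2) * (l1 (x' - u') + l1 (z' - u'))) := by
  have hN : (0 : ℝ) < N := by exact_mod_cast Nat.pos_of_ne_zero (NeZero.ne N)
  have hCT : 0 ≤ CT := (abs_nonneg _).trans (hT0 0 0 0 0 0 0)
  have hCK : 0 ≤ CK := nonneg_of_abs_le_mul_exp hδ.le (l1_nonneg _) (hK 0 0)
  have hCH : 0 ≤ CH := nonneg_of_abs_le_mul_exp hδ.le (l1_nonneg _) (hH 0 0)
  have hR : (0 : ℝ) ≤ R := by positivity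
  have idG : ∀ Z E : ℝ, (B.card : ℝ) ^ 2 * ((d : ℝ) + 1) ^ 3 * (CT * ((L : ℝ) + 1) * R * ((R / N) * Real.exp (2 * δ * R) *
      (CH' * CK + CH * CK')) * (CG' / N) * (N * (Z * E))) =
      (1 / N) * (((d : ℝ) + 1) ^ 3 * (B.card : ℝ) ^ 2 * CT * ((L : ℝ) + 1) * R ^ 2 * Real.exp (2 * δ * R) *
        ((CH' * CK + CH * CK') * CG') * Z) * E := by
    intro Z E
    have hNi : ((N : ℝ))⁻¹ * ((N : ℝ))⁻¹ * N = ((N : ℝ))⁻¹ := by rw [mul_assoc, inv_mul_cancel₀ hN.ne', mul_one]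
    simp only [div_eq_mul_inv, one_mul]
    calc _ = ((B.card : ℝ) ^ 2 * ((d : ℝ) + 1) ^ 3 * CT * ((L : ℝ) + 1) * R * R * Real.exp (2 * δ * R) *
        (CH' * CK + CH * CK') * CG' * Z * E) * (((N : ℝ))⁻¹ * ((N : ℝ))⁻¹ * N) := by ring
      _ = _ := by rw [hNi]; ring
  have hAG : ∀ (κ l l' : Fin (d + 1)) v, |H κ v * K l' v| ≤ CH * CK *
      Real.exp (-δ * (l1 (quo N v - u') + l1 (quo N v - z'))) := by
    intro κ _ l' v
    rw [abs_mul, show -δ * (l1 (quo N v - u') + l1 (quo N v - z')) = -δ * l1 (quo N v - u') + -δ * l1 (quo N v - z') by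
      ring, Real.exp_add]
    calc |H κ v| * |K l' v| ≤ (CH * Real.exp (-δ * l1 (quo N v - u'))) * (CK * Real.exp (-δ * l1 (quo N v - z'))) :=
          mul_le_mul (hH κ v) (hK l' v) (abs_nonneg _) ((abs_nonneg _).trans (hH κ v))
      _ = _ := by ring
  have hAG' : ∀ (κ l l' : Fin (d + 1)) v b, LatticeForm.l1 b ≤ R → |H κ (v - b) * K l' (v - b) - H κ v * K l' v| ≤
      (R / N) * Real.exp (2 * δ * R) * (CH' * CK + CH * CK') * Real.exp (-δ * (l1 (quo N v - u') + l1 (quo N v - z'))) :=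
    fun κ _ l' v b hb => abs_prod_shift_sub_le N hδ.le hCH' hCK' (hH κ) (hH' κ) (hK l') (hK' l') v hb
  have hGβ : ∀ (l l' : Fin (d + 1)) v j, |G l (v + Pi.single j 1) - G l v| ≤ CG' / N * Real.exp (-δ * l1 (quo N v - x')) :=
    fun l _ v j => hG' l v j
  have hT00 : ∀ κ s t l l', |T κ 0 s t l l'| ≤ CT := fun κ s t l l' => hT0 κ 0 s t l l'
  have hoffs : ∀ s ∈ B, ∀ t ∈ B, LatticeForm.l1 ((fun (s _ : Fin (d + 1) → ℤ) => s) s t) ≤ R := fun s hs t _ => hB s hs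
  have bG := abs_tsum_group_le N L (fun κ _ l' v => H κ v * K l' v) (fun l _ => G l) (fun κ s t l l' => T κ 0 s t l l')
    (fun s _ => s) B u' z' x' (c := ((N : ℝ) ^ (d + 1))⁻¹ * N) hδ (by positivity) hlam0 hlamL (by positivity)
    (div_nonneg hCG' hN.le) hAG hAG' hGβ hoffs hT00
  have hS3 : (((N : ℝ) ^ (d + 1))⁻¹ * N) * ∑' v, Real.exp (-δ * (l1 (quo N v - u') + l1 (quo N v - z') + l1 (quo N v - x')))
      ≤ N * (Zl (d + 1) (δ / 2) * Real.exp (-(δ / 2) * (l1 (x' - u') + l1 (z' - u')))) := by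
    rw [mul_comm (((N : ℝ) ^ (d + 1))⁻¹), mul_assoc, ← tsum_mul_left]
    refine mul_le_mul_of_nonneg_left ?_ hN.le
    refine le_trans (le_of_eq (tsum_congr fun v => ?_)) (TaylorBlockSum.blockSum_exp_le (N := N) hδ x' u' z')
    rw [add_comm (l1 (quo N v - u') + l1 (quo N v - z')) (l1 (quo N v - x')), ← add_assoc]
  refine bG.trans ?_
  rw [← idG]
  have e : (((N : ℝ) ^ (d + 1))⁻¹ * N) * CT * ((L : ℝ) + 1) * R * ((R / N) * Real.exp (2 * δ * R) * (CH' * CK + CH * CK')) *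
      (CG' / N) * ∑' v, Real.exp (-δ * (l1 (quo N v - u') + l1 (quo N v - z') + l1 (quo N v - x'))) =
      CT * ((L : ℝ) + 1) * R * ((R / N) * Real.exp (2 * δ * R) * (CH' * CK + CH * CK')) * (CG' / N) *
      ((((N : ℝ) ^ (d + 1))⁻¹ * N) * ∑' v, Real.exp (-δ * (l1 (quo N v - u') + l1 (quo N v - z') + l1 (quo N v - x')))) := by
    ring
  rw [e]
  have h0 : 0 ≤ CT * ((L : ℝ) + 1) * R * ((R / N) * Real.exp (2 * δ * R) * (CH' * CK + CH * CK')) * (CG' / N) := by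
    positivity
  exact mul_le_mul_of_nonneg_left (mul_le_mul_of_nonneg_left hS3 h0) (by positivity)

/-- [folklore] THE MIXED GROUP of `(II)` in the final `1/N` form (two box steps, W4). -/
theorem abs_tsum_mixed_le (hδ : 0 < δ) (hCG' : 0 ≤ CG') (hCK' : 0 ≤ CK')
    (hG' : ∀ l w j, |G l (w + Pi.single j 1) - G l w| ≤ CG' / N * Real.exp (-δ * l1 (quo N w - x')))
    (hK' : ∀ l y j, |K l (y + Pi.single j 1) - K l y| ≤ CK' / N * Real.exp (-δ * l1 (quo N y - z')))
    (hH : ∀ κ v, |H κ v| ≤ CH * Real.exp (-δ * l1 (quo N v - u')))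
    (hB : ∀ s ∈ B, LatticeForm.l1 s ≤ R) (hT0 : ∀ κ v w y l l', |T κ v w y l l'| ≤ CT)
    {lam : ℝ} (hlam0 : 0 ≤ lam) (hlamL : lam * (box (d + 1) L).card = L) :
    |∑' v, ∑ t ∈ B, ∑ s ∈ B, ∑ l' : Fin (d + 1), ∑ l : Fin (d + 1), ∑ κ : Fin (d + 1),
        (((N : ℝ) ^ (d + 1))⁻¹ * N) * (H κ v * T κ 0 s t l l') *
          (lam * (∑ r ∈ box (d + 1) L, (G l (v + quo L (toSite r + s)) - G l v) *
            (K l' (v + quo L (toSite r + t)) - K l' v)) - (G l (v + s) - G l v) * (K l' (v + t) - K l' v))| ≤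
      (1 / N) * (((d : ℝ) + 1) ^ 3 * (B.card : ℝ) ^ 2 * CT * ((L : ℝ) + 1) * R ^ 2 * Real.exp (2 * δ * R) *
        (CH * CG' * CK') * Zl (d + 1) (δ / 2)) * Real.exp (-(δ / 2) * (l1 (x' - u') + l1 (z' - u'))) := by
  have hN : (0 : ℝ) < N := by exact_mod_cast Nat.pos_of_ne_zero (NeZero.ne N)
  have idM : ∀ Z E : ℝ, (B.card : ℝ) ^ 2 * ((d : ℝ) + 1) ^ 3 * ((N : ℝ) * CT * CH * ((L : ℝ) + 1) * R ^ 2 * (CG' / N) *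
      (CK' / N) * Real.exp (2 * δ * R)) * Z * E =
      (1 / N) * (((d : ℝ) + 1) ^ 3 * (B.card : ℝ) ^ 2 * CT * ((L : ℝ) + 1) * R ^ 2 * Real.exp (2 * δ * R) *
        (CH * CG' * CK') * Z) * E := by
    intro Z E
    have hNi : ((N : ℝ))⁻¹ * ((N : ℝ))⁻¹ * N = ((N : ℝ))⁻¹ := by rw [mul_assoc, inv_mul_cancel₀ hN.ne', mul_one]
    simp only [div_eq_mul_inv, one_mul]
    calc _ = ((B.card : ℝ) ^ 2 * ((d : ℝ) + 1) ^ 3 * CT * CH * ((L : ℝ) + 1) * R ^ 2 * CG' * CK' *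
        Real.exp (2 * δ * R) * Z * E) * (((N : ℝ))⁻¹ * ((N : ℝ))⁻¹ * N) := by ring
      _ = _ := by rw [hNi]; ring
  have hFN := fun v => abs_mixed_le N L G K H T B x' z' u' (c := (N : ℝ)) hδ.le hN.le hlam0 hlamL hCG' hCK' hG' hK' hH hB
    hT0 (Nat.pos_of_ne_zero (NeZero.ne L)) v
  have h := TaylorBlockSum.abs_tsum_blockAvg_le₃ (N := N) hδ hFN
  rw [← idM]
  refine le_trans (le_of_eq ?_) h
  congr 1
  refine tsum_congr fun v => ?_
  simp only [Finset.mul_sum]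
  exact Finset.sum_congr rfl fun _ _ => Finset.sum_congr rfl fun _ _ => Finset.sum_congr rfl fun _ _ =>
    Finset.sum_congr rfl fun _ _ => Finset.sum_congr rfl fun _ _ => by ring

/-- [folklore] **`(II)` — THE LEVEL-`N′` FUNCTIONAL OF THE TRANSPORTED LEGS VERSUS THE LEVEL-`N` FUNCTIONAL IS `O(1/N)`.**
For level-`N` legs `G K H` with block-label decay and unit gradients (all three legs) and a translation-invariant,
zero-row-sum, finite-range table, with `N′ = L·N`:
`|Σ'_u slice N′^{-(d+1)} N′ (G∘quo L) (K∘quo L) (H∘quo L) u − Σ'_v slice N^{-(d+1)} N G K H v|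
   ≤ (1/N)·(d+1)³|B|²·C_T·(L+1)·R²·e^{2δR}·((C′_H C_G + C_H C′_G)·C′_K + (C′_H C_K + C_H C′_K)·C′_G + C_H C′_G C′_K)·Zl(δ/2)·E`
(cells `tsum_blocks`, carries + Hermite `cell_discrepancy_eq`, the pairing lemma for the two remainder groups, two box steps
for the mixed group, W4 `TaylorBlockSum.blockSum_exp_le` ∕ `abs_tsum_blockAvg_le₃` BY NAME). -/
theorem abs_tsum_transport_sub_le (hN' : N' = L * N) (hδ : 0 < δ) (hCG' : 0 ≤ CG') (hCK' : 0 ≤ CK') (hCH' : 0 ≤ CH')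
    (hG : ∀ l w, |G l w| ≤ CG * Real.exp (-δ * l1 (quo N w - x')))
    (hG' : ∀ l w j, |G l (w + Pi.single j 1) - G l w| ≤ CG' / N * Real.exp (-δ * l1 (quo N w - x')))
    (hK : ∀ l y, |K l y| ≤ CK * Real.exp (-δ * l1 (quo N y - z')))
    (hK' : ∀ l y j, |K l (y + Pi.single j 1) - K l y| ≤ CK' / N * Real.exp (-δ * l1 (quo N y - z')))
    (hH : ∀ κ v, |H κ v| ≤ CH * Real.exp (-δ * l1 (quo N v - u')))
    (hH' : ∀ κ v j, |H κ (v + Pi.single j 1) - H κ v| ≤ CH' / N * Real.exp (-δ * l1 (quo N v - u')))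
    (hB : ∀ s ∈ B, LatticeForm.l1 s ≤ R) (hT0 : ∀ κ v w y l l', |T κ v w y l l'| ≤ CT)
    (hTsum : ∀ κ v l l', ∑ s ∈ B, ∑ t ∈ B, T κ v (v + s) (v + t) l l' = 0)
    (hTinv : ∀ κ v s t l l', T κ v (v + s) (v + t) l l' = T κ 0 s t l l') :
    |∑' u, slice (((N' : ℝ) ^ (d + 1))⁻¹) N' (fun l w => G l (quo L w)) (fun l' y => K l' (quo L y))
        (fun κ u => H κ (quo L u)) T B u - ∑' v, slice (((N : ℝ) ^ (d + 1))⁻¹) N G K H T B v| ≤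
      (1 / N) * (((d : ℝ) + 1) ^ 3 * (B.card : ℝ) ^ 2 * CT * ((L : ℝ) + 1) * R ^ 2 * Real.exp (2 * δ * R) *
        ((CH' * CG + CH * CG') * CK' + (CH' * CK + CH * CK') * CG' + CH * CG' * CK') * Zl (d + 1) (δ / 2)) *
        Real.exp (-(δ / 2) * (l1 (x' - u') + l1 (z' - u'))) := by
  have hN : (0 : ℝ) < N := by exact_mod_cast Nat.pos_of_ne_zero (NeZero.ne N)
  have hL : (0 : ℝ) < L := by exact_mod_cast Nat.pos_of_ne_zero (NeZero.ne L)
  -- weights: `c := N^{-(d+1)}·N`, `λ := L^{-d}`, `N′^{-(d+1)}·N′ = λ·c`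
  obtain ⟨lam, hlam⟩ : ∃ lam : ℝ, lam = ((L : ℝ) ^ d)⁻¹ := ⟨_, rfl⟩
  have hlam0 : 0 ≤ lam := by rw [hlam]; positivity
  have hlam1 : lam * (L : ℝ) ^ d = 1 := by rw [hlam]; exact inv_mul_cancel₀ (pow_ne_zero _ hL.ne')
  have hlamL : lam * (box (d + 1) L).card = L := by
    rw [TaylorBlockSum.card_box, hlam]; push_cast; rw [pow_succ, ← mul_assoc, inv_mul_cancel₀ (pow_ne_zero _ hL.ne'), one_mul]
  have hw : ((N' : ℝ) ^ (d + 1))⁻¹ * (N' : ℝ) = lam * (((N : ℝ) ^ (d + 1))⁻¹ * N) := by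
    have hLi : ((L : ℝ))⁻¹ * L = 1 := inv_mul_cancel₀ hL.ne'
    rw [hN', hlam]; push_cast
    rw [mul_pow, pow_succ (L : ℝ) d, mul_inv, mul_inv]
    calc ((L : ℝ) ^ d)⁻¹ * (L : ℝ)⁻¹ * ((N : ℝ) ^ (d + 1))⁻¹ * ((L : ℝ) * N)
        = ((L : ℝ) ^ d)⁻¹ * (((N : ℝ) ^ (d + 1))⁻¹ * N) * (((L : ℝ))⁻¹ * L) := by ring
      _ = _ := by rw [hLi, mul_one]
  -- Step 1: cells (`tsum_blocks`)
  have hSlice1 : Summable fun u => slice (((N' : ℝ) ^ (d + 1))⁻¹) N' (fun l w => G l (quo L w))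
      (fun l' y => K l' (quo L y)) (fun κ u => H κ (quo L u)) T B u :=
    summable_sum fun t _ => summable_sum fun s _ =>
      TaylorTrilinear.summable_slice N' _ _ _ T x' z' u' (by positivity) (by positivity) hδ
        (fun l w => transport_decay hN' (hG l) w) (fun κ u => transport_decay hN' (hH κ) u)
        (fun l y => transport_decay hN' (hK l) y) hT0 t s
  have hSlice0 : Summable fun v => slice (((N : ℝ) ^ (d + 1))⁻¹) N G K H T B v :=
    summable_sum fun t _ => summable_sum fun s _ =>
      TaylorTrilinear.summable_slice N G K H T x' z' u' (by positivity) hN.le hδ hG hH hK hT0 t s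
  rw [tsum_blocks (N := L) hSlice1, ← (KKTFluctuationEnergy.summable_blocks (N := L) hSlice1).tsum_sub hSlice0]
  -- Step 2: the pointwise expansion into the three groups
  have hΨ : ∀ v, (∑ r ∈ box (d + 1) L, slice (((N' : ℝ) ^ (d + 1))⁻¹) N' (fun l w => G l (quo L w))
      (fun l' y => K l' (quo L y)) (fun κ u => H κ (quo L u)) T B ((L : ℤ) • v + toSite r)) -
      slice (((N : ℝ) ^ (d + 1))⁻¹) N G K H T B v =
      (∑ t ∈ B, ∑ s ∈ B, ∑ l' : Fin (d + 1), ∑ l : Fin (d + 1), ∑ κ : Fin (d + 1),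
        (((N : ℝ) ^ (d + 1))⁻¹ * N) * T κ 0 s t l l' * (H κ v * G l v) *
          (lam * (∑ r ∈ box (d + 1) L, rem2 (K l') (quo L (toSite r + t)) v) - rem2 (K l') t v)) +
      (∑ t ∈ B, ∑ s ∈ B, ∑ l' : Fin (d + 1), ∑ l : Fin (d + 1), ∑ κ : Fin (d + 1),
        (((N : ℝ) ^ (d + 1))⁻¹ * N) * T κ 0 s t l l' * (H κ v * K l' v) *
          (lam * (∑ r ∈ box (d + 1) L, rem2 (G l) (quo L (toSite r + s)) v) - rem2 (G l) s v)) +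
      ∑ t ∈ B, ∑ s ∈ B, ∑ l' : Fin (d + 1), ∑ l : Fin (d + 1), ∑ κ : Fin (d + 1),
        (((N : ℝ) ^ (d + 1))⁻¹ * N) * (H κ v * T κ 0 s t l l') *
          (lam * (∑ r ∈ box (d + 1) L, (G l (v + quo L (toSite r + s)) - G l v) *
            (K l' (v + quo L (toSite r + t)) - K l' v)) - (G l (v + s) - G l v) * (K l' (v + t) - K l' v)) := by
    intro v
    have h1 : ∀ r ∈ box (d + 1) L, slice (((N' : ℝ) ^ (d + 1))⁻¹) N' (fun l w => G l (quo L w))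
        (fun l' y => K l' (quo L y)) (fun κ u => H κ (quo L u)) T B ((L : ℤ) • v + toSite r) =
        slice (lam * (((N : ℝ) ^ (d + 1))⁻¹ * N)) 1 (fun l w => G l (quo L w)) (fun l' y => K l' (quo L y))
          (fun κ u => H κ (quo L u)) T B ((L : ℤ) • v + toSite r) := fun r _ => by rw [slice_weights, hw]
    rw [Finset.sum_congr rfl h1, slice_weights _ _ G K H T B v,
      cell_discrepancy_eq L G K H T B _ 1 lam hlam1 hTsum hTinv v]
    simp only [← Finset.sum_add_distrib]
    exact Finset.sum_congr rfl fun _ _ => Finset.sum_congr rfl fun _ _ => Finset.sum_congr rfl fun _ _ =>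
      Finset.sum_congr rfl fun _ _ => Finset.sum_congr rfl fun _ _ => by ring
  rw [tsum_congr hΨ]
  -- summability of the three groups
  have hAK : ∀ (κ l l' : Fin (d + 1)) v, |H κ v * G l v| ≤ CH * CG *
      Real.exp (-δ * (l1 (quo N v - u') + l1 (quo N v - x'))) := by
    intro κ l _ v
    rw [abs_mul, show -δ * (l1 (quo N v - u') + l1 (quo N v - x')) = -δ * l1 (quo N v - u') + -δ * l1 (quo N v - x') by
      ring, Real.exp_add]
    calc |H κ v| * |G l v| ≤ (CH * Real.exp (-δ * l1 (quo N v - u'))) * (CG * Real.exp (-δ * l1 (quo N v - x'))) :=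
          mul_le_mul (hH κ v) (hG l v) (abs_nonneg _) ((abs_nonneg _).trans (hH κ v))
      _ = _ := by ring
  have hAG : ∀ (κ l l' : Fin (d + 1)) v, |H κ v * K l' v| ≤ CH * CK *
      Real.exp (-δ * (l1 (quo N v - u') + l1 (quo N v - z'))) := by
    intro κ _ l' v
    rw [abs_mul, show -δ * (l1 (quo N v - u') + l1 (quo N v - z')) = -δ * l1 (quo N v - u') + -δ * l1 (quo N v - z') by
      ring, Real.exp_add]
    calc |H κ v| * |K l' v| ≤ (CH * Real.exp (-δ * l1 (quo N v - u'))) * (CK * Real.exp (-δ * l1 (quo N v - z'))) :=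
          mul_le_mul (hH κ v) (hK l' v) (abs_nonneg _) ((abs_nonneg _).trans (hH κ v))
      _ = _ := by ring
  have hSKs : Summable fun v => ∑ t ∈ B, ∑ s ∈ B, ∑ l' : Fin (d + 1), ∑ l : Fin (d + 1), ∑ κ : Fin (d + 1),
      (((N : ℝ) ^ (d + 1))⁻¹ * N) * T κ 0 s t l l' * (H κ v * G l v) *
        (lam * (∑ r ∈ box (d + 1) L, rem2 (K l') (quo L (toSite r + t)) v) - rem2 (K l') t v) :=
    summable_sum fun t _ => summable_sum fun s _ => summable_sum fun l' _ => summable_sum fun l _ =>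
      summable_sum fun κ _ => summable_group_term N L (fun κ l _ v => H κ v * G l v) (fun _ l' => K l')
        (fun κ s t l l' => T κ 0 s t l l') (fun _ t => t) u' x' z' hδ (div_nonneg hCK' hN.le) hAK
        (fun _ l' v j => hK' l' v j) t s l' l κ
  have hSGs : Summable fun v => ∑ t ∈ B, ∑ s ∈ B, ∑ l' : Fin (d + 1), ∑ l : Fin (d + 1), ∑ κ : Fin (d + 1),
      (((N : ℝ) ^ (d + 1))⁻¹ * N) * T κ 0 s t l l' * (H κ v * K l' v) *
        (lam * (∑ r ∈ box (d + 1) L, rem2 (G l) (quo L (toSite r + s)) v) - rem2 (G l) s v) :=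
    summable_sum fun t _ => summable_sum fun s _ => summable_sum fun l' _ => summable_sum fun l _ =>
      summable_sum fun κ _ => summable_group_term N L (fun κ _ l' v => H κ v * K l' v) (fun l _ => G l)
        (fun κ s t l l' => T κ 0 s t l l') (fun s _ => s) u' z' x' hδ (div_nonneg hCG' hN.le) hAG
        (fun l _ v j => hG' l v j) t s l' l κ
  have hc0 : (0 : ℝ) ≤ ((N : ℝ) ^ (d + 1))⁻¹ * N := by positivity
  have hSM := summable_of_le_three N hδ fun v => abs_mixed_le N L G K H T B x' z' u'
    (c := ((N : ℝ) ^ (d + 1))⁻¹ * N) hδ.le hc0 hlam0 hlamL hCG' hCK' hG' hK' hH hB hT0 (Nat.pos_of_ne_zero (NeZero.ne L)) v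
  rw [(hSKs.add hSGs).tsum_add hSM, hSKs.tsum_add hSGs]
  have bK := abs_tsum_groupK_le N L G K H T B x' z' u' hδ hCG' hCK' hCH' hG hG' hK' hH hH' hB hT0 hlam0 hlamL
  have bG := abs_tsum_groupG_le N L G K H T B x' z' u' hδ hCG' hCK' hCH' hG' hK hK' hH hH' hB hT0 hlam0 hlamL
  have bM := abs_tsum_mixed_le N L G K H T B x' z' u' hδ hCG' hCK' hG' hK' hH hB hT0 hlam0 hlamL
  refine (abs_add_le _ _).trans ((add_le_add ((abs_add_le _ _).trans (add_le_add bK bG)) bM).trans (le_of_eq ?_))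
  ring

end BoundII


end Summit.QuantumFields.BalabanUV.Beta.GAN24.TaylorTrilinearTransportBound

end
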